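import Summits.NavierStokesRegularity.NavierStokesRegularity.Theorems.IsotropicBlobDefs
import HarnessLib

/-!
# THE `C²` WITNESS FIELD of ROUND-41 «IsotropicBlobPressureLaw» — closed form, support, centre derivative (plate (V),
parts V1 / V3 / V5₀; LEAD S-door ns-s30-p1 g4 PLATE MAP v2 2026-08-28; texts nsreg-p1 g33 `r41/Sketch45.lean`, defs =
ns-s29-p2 g5's `Theorems/IsotropicBlobDefs.lean` p674102)

Cell `ns-regularity-ideate`, seat ns-sfl-p1 g6, `--supports stmt-NavierStokesRegularity-0056 --as helper`.
The witness `witnessFieldC2 = isoField uniaxialS 0 (polyEnv 4) (dpolyEnv 4) 0` (uniaxial isotropic blob, envelope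
`(1−|x|²)₊⁴`):

* (V1) `witnessFieldC2_eq_of_lt` — for `s = ‖x‖² < 1`: `u x = ((1−s)³(1−11s/3)) • Sx + ((8/3)(1−s)³⟪x,Sx⟫) • x`
  (`S = uniaxialS = diag(−½,−½,1)`, `uniaxialS_apply`, `inner_uniaxialS : ⟪x,Sx⟫ = x₂² − (x₀²+x₁²)/2`);
  `witnessFieldC2_eq_zero_of_le` / `…_of_one_le_norm` — `u x = 0` for `‖x‖² ≥ 1`;
* (V3) `hasCompactSupport_witnessFieldC2` (support in the closed unit ball);
* (V5₀) `hasFDerivAt_witnessFieldC2_zero` / `fderiv_witnessFieldC2_zero` — `Du(0) = S`;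
  `strainQuad_witnessFieldC2_zero` — `strainQuad (fun _ => u) 0 0 e₂ = 1`; `curl_witnessFieldC2_zero` — `curl u 0 = 0`.

Next parts (separate files): (V5) `fderiv` on the open ball and `= 0` outside, (V4) `IsDivFree`, (V6) the strain
polynomial, (V2) `ContDiff ℝ 2` via `HarmonicShellLineGlue`.
HONEST FRAMING: a kinematic slice witness (τ1 side of the S-door programme); item 0056 `NoTypeII` and NS regularity are
NOT proved; no hard core is touched; no summit statement is proved by this seat.
-/

noncomputable section

open MeasureTheory Set Function Filter Metric Real InnerProductSpace
open _root_.Topology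
open scoped ENNReal NNReal RealInnerProductSpace ContDiff Laplacian
open Literature.Analysis Literature.Analysis.FluidPDE VectorCalculus

namespace Summit.NavierStokesRegularity.NavierStokesRegularity.Theorems.StrainDoors.IsotropicBlob

open Summit.NavierStokesRegularity.NavierStokesRegularity.Theorems.ArgmaxDoors
open Summit.NavierStokesRegularity.NavierStokesRegularity.Theorems.StrainDoors

set_option linter.dupNamespace false

/-! ## §1 (V1) The closed form of the witness field -/

/-- Coordinates of `uniaxialS x = (−x₀/2, −x₁/2, x₂)`. -/
theorem uniaxialS_apply (x : E3) :
    uniaxialS x 0 = -(x 0) / 2 ∧ uniaxialS x 1 = -(x 1) / 2 ∧ uniaxialS x 2 = x 2 := by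
  refine ⟨?_, ?_, ?_⟩ <;> simp [uniaxialS, uniaxialFun]

/-- The quadratic form of the uniaxial strain: `⟪x, Sx⟫ = x₂² − (x₀² + x₁²)/2`. -/
theorem inner_uniaxialS (x : E3) : ⟪x, uniaxialS x⟫ = (x 2) ^ 2 - ((x 0) ^ 2 + (x 1) ^ 2) / 2 := by
  obtain ⟨h0, h1, h2⟩ := uniaxialS_apply x
  rw [EuclideanSpace.inner_eq_star_dotProduct, dotProduct, Fin.sum_univ_three]
  simp only [star_trivial]
  change uniaxialS x 0 * x 0 + uniaxialS x 1 * x 1 + uniaxialS x 2 * x 2 = _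
  rw [h0, h1, h2]
  ring

/-- **(V1) CLOSED FORM INSIDE THE BALL**: for `s = ‖x‖² < 1`,
`witnessFieldC2 x = ((1−s)³(1−11s/3)) • Sx + ((8/3)(1−s)³⟪x,Sx⟫) • x`. -/
theorem witnessFieldC2_eq_of_lt {x : E3} (hx : ‖x‖ ^ 2 < 1) :
    witnessFieldC2 x = ((1 - ‖x‖ ^ 2) ^ 3 * (1 - 11 * ‖x‖ ^ 2 / 3)) • uniaxialS x +
      (8 / 3 * (1 - ‖x‖ ^ 2) ^ 3 * ⟪x, uniaxialS x⟫) • x := by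
  have hp : polyEnv 4 (‖x‖ ^ 2) = (1 - ‖x‖ ^ 2) ^ 4 := by simp only [polyEnv, if_pos hx]
  have hd : dpolyEnv 4 (‖x‖ ^ 2) = -4 * (1 - ‖x‖ ^ 2) ^ 3 := by
    simp only [dpolyEnv, if_pos hx]; norm_num
  change isoField uniaxialS 0 (polyEnv 4) (dpolyEnv 4) 0 x = _
  unfold isoField
  rw [hp, hd]
  have h1 : (1 - ‖x‖ ^ 2) ^ 4 + 2 / 3 * ‖x‖ ^ 2 * (-4 * (1 - ‖x‖ ^ 2) ^ 3) =
      (1 - ‖x‖ ^ 2) ^ 3 * (1 - 11 * ‖x‖ ^ 2 / 3) := by ring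
  have h2 : -(2 / 3 * (-4 * (1 - ‖x‖ ^ 2) ^ 3) * ⟪x, uniaxialS x⟫) =
      8 / 3 * (1 - ‖x‖ ^ 2) ^ 3 * ⟪x, uniaxialS x⟫ := by ring
  have h3 : (0 : ℝ → ℝ) (‖x‖ ^ 2) • (0 : E3 →L[ℝ] E3) x = 0 := by simp
  rw [h3, add_zero, h1, sub_eq_add_neg, ← neg_smul, h2]

/-- **(V1) THE WITNESS VANISHES OUTSIDE THE OPEN UNIT BALL**: `witnessFieldC2 x = 0` for `1 ≤ ‖x‖²`. -/
theorem witnessFieldC2_eq_zero_of_le {x : E3} (hx : 1 ≤ ‖x‖ ^ 2) : witnessFieldC2 x = 0 := by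
  have hx' : ¬ ‖x‖ ^ 2 < 1 := not_lt.2 hx
  have hp : polyEnv 4 (‖x‖ ^ 2) = 0 := by simp only [polyEnv, if_neg hx']
  have hd : dpolyEnv 4 (‖x‖ ^ 2) = 0 := by simp only [dpolyEnv, if_neg hx']
  change isoField uniaxialS 0 (polyEnv 4) (dpolyEnv 4) 0 x = 0
  unfold isoField
  rw [hp, hd]
  simp

/-- `witnessFieldC2 x = 0` for `1 ≤ ‖x‖`. -/
theorem witnessFieldC2_eq_zero_of_one_le_norm {x : E3} (hx : 1 ≤ ‖x‖) : witnessFieldC2 x = 0 :=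
  witnessFieldC2_eq_zero_of_le (by nlinarith)

/-! ## §2 (V3) Compact support -/

/-- **(V3)** The witness field is supported in the closed unit ball, hence compactly supported. -/
theorem hasCompactSupport_witnessFieldC2 : HasCompactSupport witnessFieldC2 := by
  refine HasCompactSupport.of_support_subset_isCompact (isCompact_closedBall (0 : E3) 1) ?_
  intro x hx
  rw [mem_closedBall, dist_zero_right]
  by_contra h
  exact hx (witnessFieldC2_eq_zero_of_one_le_norm (not_le.1 h).le)

/-! ## §3 (V5₀) The derivative at the centre -/

/-- The open unit ball `{‖x‖² < 1}` is a neighbourhood of the centre. -/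
theorem ball_sq_mem_nhds_zero : {x : E3 | ‖x‖ ^ 2 < 1} ∈ 𝓝 (0 : E3) := by
  have hopen : IsOpen {x : E3 | ‖x‖ ^ 2 < 1} := isOpen_lt (continuous_norm.pow 2) continuous_const
  exact hopen.mem_nhds (by simp)

/-- On a neighbourhood of the centre the witness field is the explicit `C^∞` expression of (V1). -/
theorem witnessFieldC2_eventuallyEq_zero :
    witnessFieldC2 =ᶠ[𝓝 (0 : E3)] fun x =>
      ((1 - ‖x‖ ^ 2) ^ 3 * (1 - 11 * ‖x‖ ^ 2 / 3)) • uniaxialS x + (8 / 3 * (1 - ‖x‖ ^ 2) ^ 3 * ⟪x, uniaxialS x⟫) • x :=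
  Filter.eventually_of_mem ball_sq_mem_nhds_zero fun _ hx => witnessFieldC2_eq_of_lt hx

/-- **(V5₀) `D(witnessFieldC2)(0) = S = diag(−½,−½,1)`**: the centre derivative of the witness is the uniaxial strain. -/
theorem hasFDerivAt_witnessFieldC2_zero : HasFDerivAt witnessFieldC2 uniaxialS 0 := by
  -- the two scalar envelopes are differentiable at the centre
  have hn : DifferentiableAt ℝ (fun x : E3 => ‖x‖ ^ 2) 0 := (contDiff_norm_sq ℝ (n := 1)).differentiable one_ne_zero 0
  have ha : DifferentiableAt ℝ (fun x : E3 => (1 - ‖x‖ ^ 2) ^ 3 * (1 - 11 * ‖x‖ ^ 2 / 3)) 0 := by fun_prop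
  have hc : DifferentiableAt ℝ (fun x : E3 => 8 / 3 * (1 - ‖x‖ ^ 2) ^ 3 * ⟪x, uniaxialS x⟫) 0 := by
    have hi : DifferentiableAt ℝ (fun x : E3 => ⟪x, uniaxialS x⟫) 0 :=
      (differentiableAt_id).inner ℝ uniaxialS.differentiableAt
    fun_prop
  have hS : HasFDerivAt (fun x : E3 => uniaxialS x) uniaxialS 0 := uniaxialS.hasFDerivAt
  have hid : HasFDerivAt (fun x : E3 => x) (ContinuousLinearMap.id ℝ E3) 0 := hasFDerivAt_id 0
  have h1 := ha.hasFDerivAt.smul hS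
  have h2 := hc.hasFDerivAt.smul hid
  have h := h1.add h2
  simp only [map_zero, norm_zero, ne_eq, OfNat.ofNat_ne_zero, not_false_eq_true, zero_pow, sub_zero, one_pow,
    mul_zero, zero_div, one_mul, inner_zero_left, ContinuousLinearMap.smulRight_zero, add_zero, zero_smul,
    one_smul] at h
  exact h.congr_of_eventuallyEq witnessFieldC2_eventuallyEq_zero

/-- `fderiv ℝ witnessFieldC2 0 = uniaxialS`. -/
theorem fderiv_witnessFieldC2_zero : fderiv ℝ witnessFieldC2 0 = uniaxialS :=
  hasFDerivAt_witnessFieldC2_zero.fderiv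

/-- **(V5₀) The strain quadratic form of the witness at the centre in the axial direction is `1`**:
`strainQuad (fun _ => witnessFieldC2) 0 0 e₂ = ⟪S e₂, e₂⟫ = 1`. -/
theorem strainQuad_witnessFieldC2_zero :
    strainQuad (fun _ => witnessFieldC2) 0 0 (EuclideanSpace.single 2 1) = 1 := by
  rw [strainQuad, fderiv_witnessFieldC2_zero]
  obtain ⟨h0, h1, h2⟩ := uniaxialS_apply (EuclideanSpace.single (2 : Fin 3) (1 : ℝ))
  rw [EuclideanSpace.inner_eq_star_dotProduct, dotProduct, Fin.sum_univ_three]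
  simp only [star_trivial]
  change EuclideanSpace.single (2 : Fin 3) (1 : ℝ) 0 * uniaxialS (EuclideanSpace.single 2 1) 0 +
    EuclideanSpace.single (2 : Fin 3) (1 : ℝ) 1 * uniaxialS (EuclideanSpace.single 2 1) 1 +
    EuclideanSpace.single (2 : Fin 3) (1 : ℝ) 2 * uniaxialS (EuclideanSpace.single 2 1) 2 = 1
  rw [h0, h1, h2]
  simp

/-- **(V5₀) The witness is irrotational at the centre**: `curl witnessFieldC2 0 = 0` (its centre derivative is symmetric). -/
theorem curl_witnessFieldC2_zero : curl witnessFieldC2 0 = 0 := by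
  rw [curl]
  simp only [fderiv_witnessFieldC2_zero]
  ext i
  fin_cases i <;> simp [uniaxialS, uniaxialFun]

end Summit.NavierStokesRegularity.NavierStokesRegularity.Theorems.StrainDoors.IsotropicBlob

end
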